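import Summits.BirchSwinnertonDyer.BirchSwinnertonDyer.Theorems.EdixhovenFibreFiveSevenStarredOptimalManinUnitFiveSevenTransportedReciprocityTransportAllPoints
import Literature.NumberTheory.PAdicHodge.FormalDivisionTowersOrdinary
import HarnessLib

/-!
# Kato's explicit reciprocity law at ALL points of `W(K_v)` for `W/K₀` isomorphic to a good `𝒪_D`-model FROM the formula at the points over deep FORMAL points —
# the GENERIC off-level step of `…TransportedReciprocityTransportAllPoints` (E4/E5) abstracted over its formal-point input (E3's output shape)

Cell `pub/bsd-wall`, D-0145 line `route-BirchSwinnertonDyer-EdixhovenFibreFiveSeven`, seat `bsd-line-edix-p4` (gen 29, width); crux K★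
`stmt-BirchSwinnertonDyer-22226` (`StarredOptimalManinUnitFiveSeven`), line `kato_lever`, stub `stub_localFormulaOrdinaryCells` (memo
`Cruxes/StarredOptimalManinUnitFiveSeven/Lines/kato-lever-seam-rec-at-cells.md` §17: «(B3) assembly … then the E3–E6 twins (formula transport along `C • (W′⊗F) = E`,
mechanical: swap the T5 input)»). THEOREMS ONLY (no definition, no named fact, no instance, no `sorry`); helper `--supports stmt-BirchSwinnertonDyer-22226`.
**BSD is not proved by this file, and neither is K★ or the LOC@ord stub.** Companion of `…TransportedReciprocityAllPointsOfFormalPoints` (p795547: the same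
abstraction for the MODEL itself, T5-C ⟹ T5-D). Here: the TRANSPORT setting of edix-p4 g28's E3 ⟹ E4/E5 — `W/K₀`, `K₀ ⊆ F = K_v`,
`φ : (W ⊗ F)(F̄) ≃ E(F̄)` onto the good model `E = curveFO F (W_D ⊗_ψ 𝒪_F)`, `φ_F : W(F) → E(F)` under it. The formula at the points of `W(F)` over deep formal
points of `E` is a HYPOTHESIS `hformalT` of EXACTLY E3's output shape (`…TransportedReciprocityTransport.exists_const_tatePairingPoint_eq_neg_trace_of_omegaPeriod_ne_zero_transport`),
except that the division sequence `Q` of `P` in `W(F̄)` may be assumed to map to FORMAL points of `E` at EVERY level (`hker : ∀ n`, what the ORDINARY capstone in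
the unit-root frame can deliver through `FormalTateModuleInclusion.tateModuleOfPt_kummerCocycleO`); the model is only assumed to have `Δ ∈ 𝒪_Fˣ` and `[Xᵖ][p]` a unit
in `𝒪_{ℂ_F}` (hypothesis `h1` of `FormalGroupDivisionHeightOne`; on the K★ ordinary cells `…OrdinaryCellsModels`). The proofs are E4/E5's, with the division sequence of
each `Q` CHOSEN formal: the formal tower of `φ_F Q` in `E(F̄)` (`FormalDivisionTowersOrdinary.exists_divSeq_geomToCO_mem_kernel`, p794112) pulled back along `φ⁻¹`.

* ★★★ `exists_const_tatePairingPoint_eq_trace_mul_padicLog_transport_of_formalPoints` — **`hformalT` ⟹ `∃ c, ∀ η, ∀ P ∈ W(F): ⟨[η], P⟩_W =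
  Tr_{F/ℚ_p}(c · exp*_d(η) · log_ω^E(φ_F P))`** (E4's shape);
* ★★★ `…_transport_of_formalPoints_of_log_eq` — with `log_ω^E ∘ φ_F = u · log_ω^{W ⊗ F}`: **`⟨[η], P⟩_W = Tr_{F/ℚ_p}(c · exp*_d(η) · log_ω^{W ⊗ F}(P))`** (E5 = the `hrec′`
  shape of `…ReciprocityTowerFromAbove` / the socket before the cell numerology).

What a consumer supplies: `hformalT` = the ORDINARY capstone in transport form (the ordinary E3); then E6's change of variables (`VariableChangeTransportData`, `|u| ≤ 1` =
`…OrdinaryCellsModels.valuation_u_le_one_of_smul_eq_curveFO`) and the cell numerology as in `…LocalFormulaSupersingularCellsNumerology`.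

References: [cite: Kato1993LNM1553, Ch. II Thm. 1.4.1 (3)–(4), Lemma 1.4.3] · [cite: BlochKato1990, Ex. 3.10.1, Example 3.11] ·
[cite: SilvermanAEC2009, Thm. IV.6.4, Prop. VII.2.1–VII.2.2, III.1 Table 3.1, X §4].
-/

set_option autoImplicit false
-- single-conjunct summit: `Summit.BirchSwinnertonDyer.BirchSwinnertonDyer.…` repeats the name by design
set_option linter.dupNamespace false

noncomputable section

open Field Function ValuativeRel WittVector NumberField IsDedekindDomain
open scoped NumberField Topology Classical NNReal
open Literature.NumberTheory.PAdicHodge Literature.NumberTheory.GaloisRepresentations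
  Literature.NumberTheory.GaloisRepresentations.IsNonarchimedeanLocalField Literature.NumberTheory.GaloisRepresentations.LubinTate
  Literature.NumberTheory.GaloisCohomology Literature.NumberTheory.EllipticCurves Literature.NumberTheory.EllipticCurves.FormalGroupChart
  Literature.NumberTheory.PAdicHodge.GaloisContinuity Literature.IUT.LogVolume Literature.RingTheory.FormalGroups
  Literature.AlgebraicGeometry.Resolution _root_.WeierstrassCurve

namespace Summit.BirchSwinnertonDyer.BirchSwinnertonDyer.Theorems.TransportedReciprocityTransportAllPointsOfFormalPoints

variable {K : Type} [Field K] [NumberField K] {p : ℕ} [hprime : Fact p.Prime] (v : HeightOneSpectrum (𝓞 K))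
  [CharZero (v.adicCompletion K)] [Fact (¬ IsUnit (p : integerC (v.adicCompletion K)))]
  [IsAdicComplete (Ideal.span {(p : integerC (v.adicCompletion K))}) (integerC (v.adicCompletion K))]
  [CharZero (CompletedAlgClosure (v.adicCompletion K))]
  (hpv : valuation (v.adicCompletion K) (p : v.adicCompletion K) < 1)
  (Dv : EisensteinRoot (v.adicCompletion K) p hpv) (Wm : WeierstrassCurve (EisensteinRoot.CoeffDisc Dv))
  (ψm : EisensteinRoot.CoeffDisc Dv →+* LTCoeff (v.adicCompletion K))
  (hψm : ∀ c, algebraMap (LTCoeff (v.adicCompletion K)) (v.adicCompletion K) (ψm c) = EisensteinRoot.CoeffDisc.toF Dv c)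
  (hΔ : IsUnit (Wm.map ψm).Δ)
  (h1 : IsUnit (algebraMap (LTCoeff (v.adicCompletion K)) (CBall (v.adicCompletion K)) (PowerSeries.coeff p ((Wm.map ψm).formalMul p))))
  [(AinfTop.curveFO (v.adicCompletion K) (Wm.map ψm)).IsElliptic]
  [(curveOver (CompletedAlgClosure (v.adicCompletion K)) (Wm.map ψm)).IsElliptic]
  -- the curve `W/K₀` and the isomorphism of geometric points onto the good model
  {K₀ : Type} [Field K₀] [CharZero K₀] (W : WeierstrassCurve K₀) [W.IsElliptic] [Algebra K₀ (v.adicCompletion K)]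
  (φ : geomPoints (W.baseChange (v.adicCompletion K)) ≃+ (AinfTop.curveFO (v.adicCompletion K) (Wm.map ψm)).geomPoints)
  -- the Weil tower of `W`
  (e : (k : ℕ) → geomTorsion W ((p ^ k : ℕ) : ℤ) → geomTorsion W ((p ^ k : ℕ) : ℤ) → AlgebraicClosure K₀)
  (hμ : ∀ k S T, e k S T ^ (p ^ k) = 1) (hadd₁ : ∀ k S₁ S₂ T, e k (S₁ + S₂) T = e k S₁ T * e k S₂ T)
  (hadd₂ : ∀ k S T₁ T₂, e k S (T₁ + T₂) = e k S T₁ * e k S T₂)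
  (hgal : ∀ k (σ : absoluteGaloisGroup K₀) (S T : geomTorsion W ((p ^ k : ℕ) : ℤ)), σ • e k S T = e k (σ • S) (σ • T))
  (hcompat : ∀ k (S T : geomTorsion W ((p ^ (k + 1) : ℕ) : ℤ)),
    e k (torsionMulHom W (p ^ (k + 1)) (p ^ k) p (pow_succ p k).symm S)
      (torsionMulHom W (p ^ (k + 1)) (p ^ k) p (pow_succ p k).symm T) = e (k + 1) S T ^ p)
  -- the valuation for `log_ω` and the `F`-rational map under `φ`
  (w : Valuation (v.adicCompletion K) ℝ≥0) [w.Compatible] [(AinfTop.curveFO (v.adicCompletion K) (Wm.map ψm)).IsIntegral w.integer]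
  (φF : (W.baseChange (v.adicCompletion K)).toAffine.Point →+ (AinfTop.curveFO (v.adicCompletion K) (Wm.map ψm)).toAffine.Point)
  (hφF : ∀ P, φ (toGeomPoints (W.baseChange (v.adicCompletion K)) P) = toGeomPoints (AinfTop.curveFO (v.adicCompletion K) (Wm.map ψm)) (φF P))

set_option maxHeartbeats 3200000 in
include hΔ h1 hψm hφF in
/-- ★★★ **ALL points of `W(F)` from the points over deep FORMAL points of the model — generic off-level step in the transport setting.**
HYPOTHESIS `hformalT` (E3's output shape, with the division sequence allowed to map to formal points at every level): for some `c ∈ F`, for every cocycle `η` of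
`T_pW|_{Γ_F}`, every `P ∈ W(F)`, every `p`-power division sequence `Q` of `P` in `W(F̄)` with `φ(Q n) ∈ E₁(ℂ_F)` for ALL `n` and `‖z(φ Q₀)‖^N ≤ ‖p‖`, and every `c_P ∈ F` with
`ι(c_P) = p^N·Σ'[Xʲ]log_{W_D}·z(φ Q₀)ʲ`: `⟨[η], P⟩_W = −Tr_{F/ℚ_p}(c_P · exp*_d(η) · c)`. CONCLUSION: ONE `c' ∈ F` with
**`⟨[η], P⟩_W = Tr_{F/ℚ_p}(c' · exp*_d(η) · log_ω^E(φ_F P))` for every `η` and EVERY `P ∈ W(F)`** (`log_ω^E = padicLogPointFiniteExt w E p`). Inputs: `Δ ∈ 𝒪_Fˣ`, `[Xᵖ][p]` a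
unit in `𝒪_{ℂ_F}` (formal division towers of `F̄`-points of `E`, pulled back along `φ⁻¹`), `N ≥ 1`, the chart and the index step of E4.
[cite: Kato1993LNM1553, Ch. II Thm. 1.4.1 (3)–(4), Lemma 1.4.3] [cite: BlochKato1990, Ex. 3.10.1, Example 3.11] [cite: SilvermanAEC2009, Thm. IV.6.4, Prop. VII.2.1–VII.2.2] -/
theorem exists_const_tatePairingPoint_eq_trace_mul_padicLog_transport_of_formalPoints {N : ℕ} (hN0 : N ≠ 0)
    (d : letI := LocalField.padicAlgebra (v.adicCompletion K) p hpv
      (bdRPeriodRingData (F := (v.adicCompletion K)) (p := p) hpv).FilZeroLine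
        (restrictedRationalTateRep W (v.adicCompletion K) p))
    (hformalT : letI := LocalField.padicAlgebra (v.adicCompletion K) p hpv
      ∃ c : v.adicCompletion K,
      ∀ (η : contOneCocycles (restrictedTateRep W (v.adicCompletion K) p).toTopRep)
        (P : (W.baseChange (v.adicCompletion K)).toAffine.Point)
        (Q : ℕ → geomPoints (W.baseChange (v.adicCompletion K)))
        (_hQ : ∀ n, p • Q (n + 1) = Q n)
        (_hQ0 : Q 0 = toGeomPoints (W.baseChange (v.adicCompletion K)) P)
        (hker : ∀ n, AinfTop.geomToCO (Wm.map ψm) ((⇑φ ∘ Q) n) ∈ kernel (NormedField.valuation (K := CompletedAlgClosure (v.adicCompletion K)))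
          (curveOver (CompletedAlgClosure (v.adicCompletion K)) (Wm.map ψm))),
        ‖((zPt (AinfTop.geomToCO (Wm.map ψm) ((⇑φ ∘ Q) 0)) (hker 0) : CBall (v.adicCompletion K)) : CompletedAlgClosure (v.adicCompletion K))‖ ^ N ≤
            ‖(p : CompletedAlgClosure (v.adicCompletion K))‖ →
        ∀ cP : v.adicCompletion K,
          algebraMap (v.adicCompletion K) (CompletedAlgClosure (v.adicCompletion K)) cP =
            (p : CompletedAlgClosure (v.adicCompletion K)) ^ N *
              ∑' j : ℕ, PowerSeries.coeff j (Wm.map ((CBall (v.adicCompletion K)).subtype.comp (EisensteinRoot.CoeffDisc.toCBall Dv))).formalLog *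
                ((zPt (AinfTop.geomToCO (Wm.map ψm) ((⇑φ ∘ Q) 0)) (hker 0) : CBall (v.adicCompletion K)) : CompletedAlgClosure (v.adicCompletion K)) ^ j →
          ((tatePairingPoint W (v.adicCompletion K) p e hμ hadd₁ hadd₂ hgal hcompat
              (oneCocycleClass _ η) P : ℤ_[p]) : ℚ_[p]) =
            -Algebra.trace ℚ_[p] (v.adicCompletion K) (cP * (expStarCoord W hpv d η * c))) :
    letI := LocalField.padicAlgebra (v.adicCompletion K) p hpv
    ∃ c : v.adicCompletion K,
      ∀ (η : contOneCocycles (restrictedTateRep W (v.adicCompletion K) p).toTopRep) (P : (W.baseChange (v.adicCompletion K)).toAffine.Point),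
        ((tatePairingPoint W (v.adicCompletion K) p e hμ hadd₁ hadd₂ hgal hcompat (oneCocycleClass _ η) P : ℤ_[p]) : ℚ_[p]) =
          Algebra.trace ℚ_[p] (v.adicCompletion K)
            (c * expStarCoord W hpv d η *
              padicLogPointFiniteExt w (AinfTop.curveFO (v.adicCompletion K) (Wm.map ψm)) p (φF P)) := by
  letI := LocalField.padicAlgebra (v.adicCompletion K) p hpv
  obtain ⟨c₀, hc₀⟩ := hformalT
  refine ⟨-((p : v.adicCompletion K) ^ N * c₀), fun η P => ?_⟩
  have hp0 : (p : v.adicCompletion K) ≠ 0 := Nat.cast_ne_zero.2 hprime.out.ne_zero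
  have hpC : ‖(p : CompletedAlgClosure (v.adicCompletion K))‖ < 1 := norm_natCast_C_lt_one hpv
  -- the formula at every `Q ∈ W(F)` with `φ_F Q` in the level of the model, `c_Q := p^N · log_ω(φ_F Q)`, along a FORMAL division tower of `φ_F Q` pulled back by `φ⁻¹`
  have hlevel : ∀ Q : (W.baseChange (v.adicCompletion K)).toAffine.Point,
      φF Q ∈ level w (AinfTop.curveFO (v.adicCompletion K) (Wm.map ψm)) (w (p : v.adicCompletion K)) →
      ((tatePairingPoint W (v.adicCompletion K) p e hμ hadd₁ hadd₂ hgal hcompat (oneCocycleClass _ η) Q : ℤ_[p]) : ℚ_[p]) =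
        -Algebra.trace ℚ_[p] (v.adicCompletion K)
          ((p : v.adicCompletion K) ^ N * padicLogPointFiniteExt w (AinfTop.curveFO (v.adicCompletion K) (Wm.map ψm)) p (φF Q) *
            (expStarCoord W hpv d η * c₀)) := by
    intro Q hQ
    have hkerE0 : AinfTop.geomToCO (Wm.map ψm) (toGeomPoints (AinfTop.curveFO (v.adicCompletion K) (Wm.map ψm)) (φF Q)) ∈
        kernel (NormedField.valuation (K := CompletedAlgClosure (v.adicCompletion K))) (curveOver (CompletedAlgClosure (v.adicCompletion K)) (Wm.map ψm)) :=
      AinfTop.geomToCO_toGeomPoints_mem_kernel _ w hQ.1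
    obtain ⟨QE, hQE0, hQE, hkerE⟩ := AinfTop.exists_divSeq_geomToCO_mem_kernel (Wm.map ψm) hpC hΔ h1
      (toGeomPoints (AinfTop.curveFO (v.adicCompletion K) (Wm.map ψm)) (φF Q)) hkerE0
    -- the pulled-back division sequence of `Q` in `W(F̄)`
    let Qs : ℕ → geomPoints (W.baseChange (v.adicCompletion K)) := fun n => φ.symm (QE n)
    have hQs : ∀ n, p • Qs (n + 1) = Qs n := fun n => by
      change p • φ.symm (QE (n + 1)) = φ.symm (QE n)
      rw [← map_nsmul, hQE]
    have hQs0 : Qs 0 = toGeomPoints (W.baseChange (v.adicCompletion K)) Q := by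
      change φ.symm (QE 0) = _
      rw [hQE0, ← hφF, AddEquiv.symm_apply_apply]
    have hφQs : ∀ n, (⇑φ ∘ Qs) n = QE n := fun n => φ.apply_symm_apply (QE n)
    have hker : ∀ n, AinfTop.geomToCO (Wm.map ψm) ((⇑φ ∘ Qs) n) ∈ kernel (NormedField.valuation (K := CompletedAlgClosure (v.adicCompletion K)))
        (curveOver (CompletedAlgClosure (v.adicCompletion K)) (Wm.map ψm)) := fun n => by rw [hφQs]; exact hkerE n
    have hz : ((zPt (AinfTop.geomToCO (Wm.map ψm) ((⇑φ ∘ Qs) 0)) (hker 0) : CBall (v.adicCompletion K)) : CompletedAlgClosure (v.adicCompletion K)) =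
        (AinfTop.geomToCO (Wm.map ψm) (toGeomPoints (AinfTop.curveFO (v.adicCompletion K) (Wm.map ψm)) (φF Q))).zCoord := by
      rw [coe_zPt, hφQs, hQE0]
    have hdepth : ‖((zPt (AinfTop.geomToCO (Wm.map ψm) ((⇑φ ∘ Qs) 0)) (hker 0) : CBall (v.adicCompletion K)) :
        CompletedAlgClosure (v.adicCompletion K))‖ ^ N ≤ ‖(p : CompletedAlgClosure (v.adicCompletion K))‖ := by
      rw [hz]; exact AinfTop.norm_zCoord_geomToCO_toGeomPoints_pow_le (Wm.map ψm) hpv w hQ hN0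
    have hcP : algebraMap (v.adicCompletion K) (CompletedAlgClosure (v.adicCompletion K))
        ((p : v.adicCompletion K) ^ N * padicLogPointFiniteExt w (AinfTop.curveFO (v.adicCompletion K) (Wm.map ψm)) p (φF Q)) =
        (p : CompletedAlgClosure (v.adicCompletion K)) ^ N *
          ∑' j : ℕ, PowerSeries.coeff j (Wm.map ((CBall (v.adicCompletion K)).subtype.comp (EisensteinRoot.CoeffDisc.toCBall Dv))).formalLog *
            ((zPt (AinfTop.geomToCO (Wm.map ψm) ((⇑φ ∘ Qs) 0)) (hker 0) : CBall (v.adicCompletion K)) : CompletedAlgClosure (v.adicCompletion K)) ^ j := by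
      rw [hz]; exact AinfTop.algebraMap_pow_mul_padicLogPointFiniteExt_curveFO_eq Dv Wm ψm hψm w hQ N
    exact hc₀ η Q Qs hQs hQs0 hker hdepth _ hcP
  -- off the level: a positive multiple of `φ_F P` lies in the level; `⟨[η], ·⟩`, `φ_F`, `log_ω` are additive; `char ℚ_p = 0`
  obtain ⟨m, hm, hmP⟩ := exists_nsmul_mem_level_of_isNonarchimedeanLocalField (AinfTop.curveFO (v.adicCompletion K) (Wm.map ψm)) w hp0 (φF P)
  have h := hlevel (m • P) (by rw [map_nsmul]; exact hmP)
  rw [map_nsmul φF m P, padicLogPointFiniteExt_nsmul_of_isNonarchimedeanLocalField (AinfTop.curveFO (v.adicCompletion K) (Wm.map ψm)) w hp0 hpv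
    (φF P) m, map_nsmul (tatePairingPoint W (v.adicCompletion K) p e hμ hadd₁ hadd₂ hgal hcompat (oneCocycleClass _ η)) m P, nsmul_eq_mul,
    PadicInt.coe_mul, PadicInt.coe_natCast] at h
  have htr : Algebra.trace ℚ_[p] (v.adicCompletion K) ((p : v.adicCompletion K) ^ N *
      ((m : v.adicCompletion K) * padicLogPointFiniteExt w (AinfTop.curveFO (v.adicCompletion K) (Wm.map ψm)) p (φF P)) * (expStarCoord W hpv d η * c₀)) =
      (m : ℚ_[p]) * Algebra.trace ℚ_[p] (v.adicCompletion K) ((p : v.adicCompletion K) ^ N *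
        padicLogPointFiniteExt w (AinfTop.curveFO (v.adicCompletion K) (Wm.map ψm)) p (φF P) * (expStarCoord W hpv d η * c₀)) := by
    rw [show (p : v.adicCompletion K) ^ N * ((m : v.adicCompletion K) *
        padicLogPointFiniteExt w (AinfTop.curveFO (v.adicCompletion K) (Wm.map ψm)) p (φF P)) * (expStarCoord W hpv d η * c₀) =
        m • ((p : v.adicCompletion K) ^ N * padicLogPointFiniteExt w (AinfTop.curveFO (v.adicCompletion K) (Wm.map ψm)) p (φF P) *
          (expStarCoord W hpv d η * c₀)) by rw [nsmul_eq_mul]; ring, LinearMap.map_smul_of_tower, nsmul_eq_mul]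
  rw [htr, ← mul_neg] at h
  have hm0 : (m : ℚ_[p]) ≠ 0 := by exact_mod_cast hm.ne'
  rw [mul_left_cancel₀ hm0 h, ← map_neg]
  congr 1
  ring

include hΔ h1 hψm hφF in
/-- ★★★ **The `hrec'` shape on the nose, from the formal-point hypothesis.** If, in addition, `log_ω^E ∘ φ_F = u · log_ω^{W ⊗ F}` for some `u ∈ F` and some valuation
`w'` of `F` for which `W ⊗ F` is integral (`FormalGroupChart.padicLogPointFiniteExt_pointMap_of_variableChange` for an admissible change of variables), then
ONE `c ∈ F` gives for every cocycle `η` of `T_pW|_{Γ_F}` and EVERY `P ∈ W(F)`: **`⟨[η], P⟩_W = Tr_{F/ℚ_p}(c · exp*_d(η) · log_ω^{W ⊗ F}(P))`** (E5's shape).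
[cite: Kato1993LNM1553, Ch. II Thm. 1.4.1 (3)–(4)] [cite: SilvermanAEC2009, III.1 Table 3.1, Thm. IV.6.4] -/
theorem exists_const_tatePairingPoint_eq_trace_mul_padicLog_transport_of_formalPoints_of_log_eq {N : ℕ} (hN0 : N ≠ 0)
    (d : letI := LocalField.padicAlgebra (v.adicCompletion K) p hpv
      (bdRPeriodRingData (F := (v.adicCompletion K)) (p := p) hpv).FilZeroLine
        (restrictedRationalTateRep W (v.adicCompletion K) p))
    (hformalT : letI := LocalField.padicAlgebra (v.adicCompletion K) p hpv
      ∃ c : v.adicCompletion K,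
      ∀ (η : contOneCocycles (restrictedTateRep W (v.adicCompletion K) p).toTopRep)
        (P : (W.baseChange (v.adicCompletion K)).toAffine.Point)
        (Q : ℕ → geomPoints (W.baseChange (v.adicCompletion K)))
        (_hQ : ∀ n, p • Q (n + 1) = Q n)
        (_hQ0 : Q 0 = toGeomPoints (W.baseChange (v.adicCompletion K)) P)
        (hker : ∀ n, AinfTop.geomToCO (Wm.map ψm) ((⇑φ ∘ Q) n) ∈ kernel (NormedField.valuation (K := CompletedAlgClosure (v.adicCompletion K)))
          (curveOver (CompletedAlgClosure (v.adicCompletion K)) (Wm.map ψm))),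
        ‖((zPt (AinfTop.geomToCO (Wm.map ψm) ((⇑φ ∘ Q) 0)) (hker 0) : CBall (v.adicCompletion K)) : CompletedAlgClosure (v.adicCompletion K))‖ ^ N ≤
            ‖(p : CompletedAlgClosure (v.adicCompletion K))‖ →
        ∀ cP : v.adicCompletion K,
          algebraMap (v.adicCompletion K) (CompletedAlgClosure (v.adicCompletion K)) cP =
            (p : CompletedAlgClosure (v.adicCompletion K)) ^ N *
              ∑' j : ℕ, PowerSeries.coeff j (Wm.map ((CBall (v.adicCompletion K)).subtype.comp (EisensteinRoot.CoeffDisc.toCBall Dv))).formalLog *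
                ((zPt (AinfTop.geomToCO (Wm.map ψm) ((⇑φ ∘ Q) 0)) (hker 0) : CBall (v.adicCompletion K)) : CompletedAlgClosure (v.adicCompletion K)) ^ j →
          ((tatePairingPoint W (v.adicCompletion K) p e hμ hadd₁ hadd₂ hgal hcompat
              (oneCocycleClass _ η) P : ℤ_[p]) : ℚ_[p]) =
            -Algebra.trace ℚ_[p] (v.adicCompletion K) (cP * (expStarCoord W hpv d η * c)))
    -- the rescaling of `log_ω` under `φ_F`
    (w' : Valuation (v.adicCompletion K) ℝ≥0) [(W.baseChange (v.adicCompletion K)).IsIntegral w'.integer] (u : v.adicCompletion K)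
    (hlogφ : ∀ P, padicLogPointFiniteExt w (AinfTop.curveFO (v.adicCompletion K) (Wm.map ψm)) p (φF P) =
      u * padicLogPointFiniteExt w' (W.baseChange (v.adicCompletion K)) p P) :
    letI := LocalField.padicAlgebra (v.adicCompletion K) p hpv
    ∃ c : v.adicCompletion K,
      ∀ (η : contOneCocycles (restrictedTateRep W (v.adicCompletion K) p).toTopRep) (P : (W.baseChange (v.adicCompletion K)).toAffine.Point),
        ((tatePairingPoint W (v.adicCompletion K) p e hμ hadd₁ hadd₂ hgal hcompat (oneCocycleClass _ η) P : ℤ_[p]) : ℚ_[p]) =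
          Algebra.trace ℚ_[p] (v.adicCompletion K)
            (c * expStarCoord W hpv d η * padicLogPointFiniteExt w' (W.baseChange (v.adicCompletion K)) p P) := by
  letI := LocalField.padicAlgebra (v.adicCompletion K) p hpv
  obtain ⟨c₀, hc₀⟩ := exists_const_tatePairingPoint_eq_trace_mul_padicLog_transport_of_formalPoints v hpv Dv Wm ψm hψm hΔ h1 W φ e hμ hadd₁ hadd₂
    hgal hcompat w φF hφF hN0 d hformalT
  refine ⟨c₀ * u, fun η P => ?_⟩
  rw [hc₀ η P, hlogφ P]
  congr 1
  ring

end Summit.BirchSwinnertonDyer.BirchSwinnertonDyer.Theorems.TransportedReciprocityTransportAllPointsOfFormalPoints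

end
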